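import Summits.RiemannHypothesis.RiemannHypothesis.Theorems.TiltedLandingLaw421E3ExitPace

/-! # TiltedLandingLaw421E3Literal
W-07 E3 THE E3 LITERAL, CLOSED — rev 2 OF RECORD (C1 rh-idea-5 g22, `sectionE5r2-W07e3-C1-rh-idea-5-g22.part` 2757350f; director (CA268)(1): ARGMAX root; critic (G2) exit A′):
`tentNodes`/`tentRealNodes`, ARGMAX `lowestRoot` (+ K `exists_argmax_lowest`, `lowestRoot_spec`, `lowestRoot_isLowest`, `lowestRoot_tentAt_eq_meterMax`: the root's 3/2-tent count
= `tentMeterMax (3/2) … 0`), guarded `dZ`, ★`D_Z := dZ (3/2) (tentRealNodes (3/2)) lowestRoot`, `E3Literal`, ★★`ZExitPaceRest` (THE REGISTRABLE TEXT: REST alone,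
EMPTY-only), `lineageLaw_DZ` (LAW is a theorem), `denseLevelCensusStopLow_of_zExitPaceRest` (⇒ v1's β-low statement), `descentSigS'_of_zExitPaceRest` (+ hand α ⇒
`DescentSigS'`), N-dial ends `exitSet_emptyNodes` / `paceMeter_zeroMeter`. Every decl other than `lowestRoot`/`lowestRoot_spec` (+3 added) is TOKEN-IDENTICAL to rev 1 (e6daa7a5).
README: `pub/ideators/rh-idea-5/g22/w07e3/`.
SUPPORT module for crux `TiltedLandingLaw421` (stmt-RiemannHypothesis-24774), `--supports` only: proves no stub, no crux; fully proved (no `sorry`).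
Cut by tenure rh-tenure-earlyapp-1 g4 per director (CA261)(C2) from the authors' farm-checked sections (decl blocks byte-verbatim; section `/-! -/` prose and
`#print axioms` lines dropped, mechanical docstrings added where absent); K = kernel-checked lemmas about MODEL sockets (combs), not ζ/Ξ. RH is not proved. -/

namespace RhW07.E3.Lit

open RhIdea6.G17.W07C7 RhIdea6.G17.W07C7.Rev6 RhIdea6.G18.W07C8.Law421BirthS RhIdea6.G19.W07C11.Seam
open RhIdea6.G20.W07C12.Frac RhIdea6.G20.W07C12.StColP RhW07.C12.FieldSplit RhIdea6.G21.W07C13.TentMax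
open RhW07.C14.TwoSided RhW07.C14.Classes RhW07.C14.Lineage RhW07.C14.Booking
open RhW07.C13.Heredity RhIdea6.G22.W07C15pre.Injection RhW07.E3.Cell

/-- TRACKED NODES, all members: level `m` ↦ the tie-UNION of the ρ-tents of the LOWEST `StCol'` states of level `m` (root argument unused). -/
def tentNodes (ρ : ℝ) : NodeFamily := fun η f x₀ s hmax R Hs B _u₀ m =>
  {z : ℂ | ∃ u : ℂ, IsLowest StCol' η f x₀ s hmax R Hs B m u ∧ z ∈ tentSet ρ f m u}

/-- TRACKED NODES OF RECORD: the REAL members of `tentNodes ρ` (RIDER-34; C2 `s3walk` convention: non-real members die at level 0). -/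
def tentRealNodes (ρ : ℝ) : NodeFamily := fun η f x₀ s hmax R Hs B u₀ m =>
  {z : ℂ | z ∈ tentNodes ρ η f x₀ s hmax R Hs B u₀ m ∧ z.im = 0}

/-- W-07 E3 support (E04 §E5 rev 2 (of record), C1 rh-idea-5 g22): see the module docstring and the source README. -/
theorem tentRealNodes_subset (ρ η : ℝ) (f : ℂ → ℂ) (x₀ s hmax R Hs : ℝ) (B : ℕ) (u₀ : ℂ) (m : ℕ) :
    tentRealNodes ρ η f x₀ s hmax R Hs B u₀ m ⊆ tentNodes ρ η f x₀ s hmax R Hs B u₀ m := fun _ hz => hz.1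

/-- CANONICAL ROOT (rev 2 — director (CA268)(1) / C4 l.5412 review, ADOPTED): a lowest level-0 `StCol'` state of MAXIMAL 3/2-tent count among the lowest
level-0 states (ARGMAX, `Classical.epsilon`; arbitrary where no lowest state exists — the meter is then guarded to 0).  With a non-maximal root `D_Z ≤ #Z(root) < T₀`
could hold on a legal two-lowest-states datum and the text's truth would hinge on ε's pick; with the argmax the text means «REST(pace `D_Z`) for a tent-maximal
lowest root» = what C6/C2 priced (ties = mirror class, sign-neutral, ADD-43 (2)/ADD-46).  `tentAt (3/2) f 0` is the count `tentMeterMax (3/2) … 0` takes its `sSup` of. -/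
noncomputable def lowestRoot : RootChoice := fun η f x₀ s hmax R Hs B =>
  Classical.epsilon (fun u : ℂ => IsLowest StCol' η f x₀ s hmax R Hs B 0 u ∧
    ∀ w : ℂ, IsLowest StCol' η f x₀ s hmax R Hs B 0 w → tentAt (3 / 2) f 0 w ≤ tentAt (3 / 2) f 0 u)

/-- (K) under the engine hypotheses, if level 0 has a lowest `StCol'` state it has a tent-count-MAXIMAL one (the lowest set is finite, `isLowest_finite`). -/
theorem exists_argmax_lowest (ρ : ℝ) {η : ℝ} {f : ℂ → ℂ} {x₀ s hmax R Hs : ℝ} {B : ℕ} (hE : EngineHyps5 2 η f x₀ s hmax R Hs B)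
    (h : ∃ u : ℂ, IsLowest StCol' η f x₀ s hmax R Hs B 0 u) :
    ∃ u : ℂ, IsLowest StCol' η f x₀ s hmax R Hs B 0 u ∧ ∀ w : ℂ, IsLowest StCol' η f x₀ s hmax R Hs B 0 w → tentAt ρ f 0 w ≤ tentAt ρ f 0 u := by
  obtain ⟨u₁, hu₁⟩ := h
  have hfin := isLowest_finite hE 0
  obtain ⟨u, hu, hmx⟩ := hfin.toFinset.exists_max_image (tentAt ρ f 0) ⟨u₁, (Set.Finite.mem_toFinset hfin).mpr hu₁⟩
  exact ⟨u, (Set.Finite.mem_toFinset hfin).mp hu, fun w hw => hmx w ((Set.Finite.mem_toFinset hfin).mpr hw)⟩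

/-- (K) the root's specification (rev 2: needs `EngineHyps5` for the finiteness behind the argmax). -/
theorem lowestRoot_spec {η : ℝ} {f : ℂ → ℂ} {x₀ s hmax R Hs : ℝ} {B : ℕ} (hE : EngineHyps5 2 η f x₀ s hmax R Hs B)
    (h : ∃ u : ℂ, IsLowest StCol' η f x₀ s hmax R Hs B 0 u) :
    IsLowest StCol' η f x₀ s hmax R Hs B 0 (lowestRoot η f x₀ s hmax R Hs B) ∧
      ∀ w : ℂ, IsLowest StCol' η f x₀ s hmax R Hs B 0 w → tentAt (3 / 2) f 0 w ≤ tentAt (3 / 2) f 0 (lowestRoot η f x₀ s hmax R Hs B) :=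
  Classical.epsilon_spec (exists_argmax_lowest (3 / 2) hE h)

/-- ★ (K, director's `lowestRoot_isLowest`) the canonical root IS a lowest level-0 `StCol'` state whenever one exists. -/
theorem lowestRoot_isLowest {η : ℝ} {f : ℂ → ℂ} {x₀ s hmax R Hs : ℝ} {B : ℕ} (hE : EngineHyps5 2 η f x₀ s hmax R Hs B)
    (h : ∃ u : ℂ, IsLowest StCol' η f x₀ s hmax R Hs B 0 u) : IsLowest StCol' η f x₀ s hmax R Hs B 0 (lowestRoot η f x₀ s hmax R Hs B) :=
  (lowestRoot_spec hE h).1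

/-- ★ (K, director's «#Z(root) = M₀», C4's `hZ` up to multiplicity) THE ROOT REALISES THE BOOKING: its 3/2-tent count is `T₀(3/2) = tentMeterMax (3/2) … 0`
(so `#Z(root) = ncard (tentSet (3/2) f 0 root) ≤ T₀`, with equality iff the root's companions are simple zeros — `card_companions_le_tentCount`). -/
theorem lowestRoot_tentAt_eq_meterMax {η : ℝ} {f : ℂ → ℂ} {x₀ s hmax R Hs : ℝ} {B : ℕ} (hE : EngineHyps5 2 η f x₀ s hmax R Hs B)
    (h : ∃ u : ℂ, IsLowest StCol' η f x₀ s hmax R Hs B 0 u) :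
    tentAt (3 / 2) f 0 (lowestRoot η f x₀ s hmax R Hs B) = tentMeterMax (3 / 2) η f x₀ s hmax R Hs B 0 := by
  obtain ⟨hlow, hmx⟩ := lowestRoot_spec hE h
  symm
  show sSup (tentAt (3 / 2) f 0 '' {u : ℂ | IsLowest StCol' η f x₀ s hmax R Hs B 0 u}) = _
  exact IsGreatest.csSup_eq ⟨⟨_, hlow, rfl⟩, fun x ⟨w, hw, hx⟩ => hx ▸ hmx w hw⟩

open Classical in
/-- the GUARDED Z-EXIT METER of `(ρ, N, root)`: C4's `exitMeter (tentChildFamily N) (tentFamily ρ) root` where `root` IS a lowest level-0 state, else `0`. -/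
noncomputable def dZ (ρ : ℝ) (N : NodeFamily) (root : RootChoice) : LevelMeter := fun η f x₀ s hmax R Hs B k =>
  if IsLowest StCol' η f x₀ s hmax R Hs B 0 (root η f x₀ s hmax R Hs B) then
    exitMeter (tentChildFamily N) (tentFamily ρ) root η f x₀ s hmax R Hs B k else 0

/-- W-07 E3 support (E04 §E5 rev 2 (of record), C1 rh-idea-5 g22): see the module docstring and the source README. -/
theorem dZ_nonneg (ρ : ℝ) (N : NodeFamily) (root : RootChoice) (η : ℝ) (f : ℂ → ℂ) (x₀ s hmax R Hs : ℝ) (B k : ℕ) :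
    0 ≤ dZ ρ N root η f x₀ s hmax R Hs B k := by
  unfold dZ
  split_ifs
  · exact exitMeter_nonneg _ _ _ _ _ _ _ _ _ _ _ _
  · exact le_refl 0

/-- ★ (K) «D ≤ M 0» FOR EVERY DATUM (C4 `exitMeter_tent_le_meterMax` under the guard, `tentMeterMax_nonneg` off it). -/
theorem dZ_le_meterMax (ρ : ℝ) (N : NodeFamily) (root : RootChoice) (η : ℝ) (f : ℂ → ℂ) (x₀ s hmax R Hs : ℝ) (B : ℕ)
    (hE : EngineHyps5 2 η f x₀ s hmax R Hs B) (k : ℕ) : dZ ρ N root η f x₀ s hmax R Hs B k ≤ tentMeterMax ρ η f x₀ s hmax R Hs B 0 := by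
  unfold dZ
  split_ifs with h
  · exact exitMeter_tent_le_meterMax (tentChildFamily N) ρ hE h k
  · exact tentMeterMax_nonneg ρ η f x₀ s hmax R Hs B 0

/-- ★ THE TOKEN `D_Z` (closed, `StCol'`-prefix; ρ = 3/2, nodes of record = real tent members of the lowest states, canonical root, guarded). -/
noncomputable def D_Z : LevelMeter := dZ (3 / 2) (tentRealNodes (3 / 2)) lowestRoot

/-- (variant, NOT of record; re-price item (γ) for C6/C2) all members tracked: a non-real member with a tracked node to its right then HAS a child. -/
noncomputable def D_Zall : LevelMeter := dZ (3 / 2) (tentNodes (3 / 2)) lowestRoot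

/-- W-07 E3 support (E04 §E5 rev 2 (of record), C1 rh-idea-5 g22): see the module docstring and the source README. -/
theorem D_Z_le_meterMax (η : ℝ) (f : ℂ → ℂ) (x₀ s hmax R Hs : ℝ) (B : ℕ) (hE : EngineHyps5 2 η f x₀ s hmax R Hs B) (k : ℕ) :
    D_Z η f x₀ s hmax R Hs B k ≤ tentMeterMax (3 / 2) η f x₀ s hmax R Hs B 0 :=
  dZ_le_meterMax (3 / 2) (tentRealNodes (3 / 2)) lowestRoot η f x₀ s hmax R Hs B hE k

/-- ★ THE E3 LITERAL ((CA255) c9-compliant, every name closed): `E3CellS (paceMeter D_Z)`. -/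
def E3Literal : Prop := E3CellS (paceMeter PSealC4 StCol' (CumReady WindowReady) (EmptyClass (3 / 2)) D_Z)

/-- ★★ THE REGISTRABLE TEXT = REST ALONE at a class `𝓔₂ ⊇` EMPTY-only (of record `𝓔₂ :=` EMPTY-only): the rest budget of the pace meter of `D_Z`
at the slack budget `S₀ = (Hs/s)² + B + 1 − T₀(3/2)`, booking `T₀(3/2)`, μ = 1/4, `StCol'`, `CumReady WindowReady`. -/
def ZExitPaceRestAt (𝓔₂ : LevelClass) : Prop :=
  RestBudget PSealC4 𝓔₂ (paceMeter PSealC4 StCol' (CumReady WindowReady) (EmptyClass (3 / 2)) D_Z)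
    (slackBudget 1 (tentMeterMax (3 / 2))) (tentMeterMax (3 / 2))

/-- ★★ `ZExitPaceRest` — the one-line registrable E3 text (REST of the Z-exit pace meter, EMPTY-only class). -/
def ZExitPaceRest : Prop := ZExitPaceRestAt (EmptyClass (3 / 2))

/-- (K) LAW IS A THEOREM for `D_Z`: the LAW conjunct of `E3Literal` is dropped from the registrable text by this lemma, not by fiat (critic (c)). -/
theorem lineageLaw_DZ :
    LineageLaw PSealC4 (EmptyClass (3 / 2)) (paceMeter PSealC4 StCol' (CumReady WindowReady) (EmptyClass (3 / 2)) D_Z) (tentMeterMax (3 / 2)) := by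
  show LineageLawG PSealC4 StCol' (CumReady WindowReady) (EmptyClass (3 / 2)) _ (tentMeterMax (3 / 2))
  exact lineageLawG_pace fun η f x₀ s hmax R Hs B hE k => D_Z_le_meterMax η f x₀ s hmax R Hs B hE k

/-- ★★ (K) REST (at any class ⊇ EMPTY-only) ⇒ THE LITERAL. -/
theorem e3Literal_of_restAt {𝓔₂ : LevelClass}
    (h₂ : ∀ η f x₀ s hmax R Hs B j, EmptyClass (3 / 2) η f x₀ s hmax R Hs B j → 𝓔₂ η f x₀ s hmax R Hs B j) (hR : ZExitPaceRestAt 𝓔₂) :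
    E3Literal :=
  e3CellS_pace_of_rest h₂ (fun η f x₀ s hmax R Hs B hE k => D_Z_le_meterMax η f x₀ s hmax R Hs B hE k) hR

/-- W-07 E3 support (E04 §E5 rev 2 (of record), C1 rh-idea-5 g22): see the module docstring and the source README. -/
theorem e3Literal_of_zExitPaceRest (hR : ZExitPaceRest) : E3Literal := e3Literal_of_restAt (fun _ _ _ _ _ _ _ _ _ h => h) hR

/-- (K) … and conversely (the text IS the literal's REST conjunct): dropping LAW loses nothing. -/
theorem e3Literal_iff_zExitPaceRest : E3Literal ↔ ZExitPaceRest := ⟨fun h => h.2.2, e3Literal_of_zExitPaceRest⟩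

/-- (K) node readings: the text ⇒ (β-low) = the registered stub's statement `DenseLevelCensusStopLow PSealC4`; + hand (α-low) ⇒ `DescentSigS'`. -/
theorem denseLevelCensusStopLow_of_zExitPaceRest (hR : ZExitPaceRest) : DenseLevelCensusStopLow PSealC4 :=
  denseLevelCensusStopLow_of_e3CellS (e3Literal_of_zExitPaceRest hR)

/-- W-07 E3 support (E04 §E5 rev 2 (of record), C1 rh-idea-5 g22): see the module docstring and the source README. -/
theorem descentSigS'_of_zExitPaceRest (hR : ZExitPaceRest) (hα : IsolatedPairDropLow PSealC4) : DescentSigS' :=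
  descentSigS'_of_e3CellS (e3Literal_of_zExitPaceRest hR) hα

/-- W-07 E3 support (E04 §E5 rev 2 (of record), C1 rh-idea-5 g22): see the module docstring and the source README. -/
theorem descentSigS'_of_zExitPaceRestAt {𝓔₂ : LevelClass}
    (h₂ : ∀ η f x₀ s hmax R Hs B j, EmptyClass (3 / 2) η f x₀ s hmax R Hs B j → 𝓔₂ η f x₀ s hmax R Hs B j) (hR : ZExitPaceRestAt 𝓔₂)
    (hα : IsolatedPairDropLow PSealC4) : DescentSigS' :=
  descentSigS'_of_e3CellS (e3Literal_of_restAt h₂ hR) hα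

/-- (K) END «N := ∅»: with no tracked nodes every member of `Z` is childless at level 0, so below any `k ≥ 1` the exit set is ALL of `Z`
(`D = |Z|`: the pace meter is the σ_min-type deficit — the c9 corner, dead by price). -/
theorem exitSet_emptyNodes (Z : Set ℂ) {k : ℕ} (hk : 1 ≤ k) : exitSet (TentChild fun _ => (∅ : Set ℂ)) Z k = Z := by
  ext z
  constructor
  · exact fun hz => hz.1
  · intro hz
    refine ⟨hz, 0, by omega, fun _ => z, rfl, fun n _ hn => absurd hn (Nat.not_lt_zero n), fun z' h => ?_⟩
    exact (Set.mem_empty_iff_false _).mp h.1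

open Classical in
/-- (K) END «no lineage ever dies» = `D := 0`: the pace meter then bills EVERY injected level (`injected` is monotone) — RIDER-33's over-billing corner, dead. -/
theorem paceMeter_zeroMeter (P St Ready : StatePred) (𝓔 : LevelClass) (η : ℝ) (f : ℂ → ℂ) (x₀ s hmax R Hs : ℝ) (B k : ℕ) :
    paceMeter P St Ready 𝓔 (fun _ _ _ _ _ _ _ _ _ => 0) η f x₀ s hmax R Hs B k = injected P St Ready 𝓔 η f x₀ s hmax R Hs B k := by
  have hmono : ∀ k : ℕ, injected P St Ready 𝓔 η f x₀ s hmax R Hs B k ≤ injected P St Ready 𝓔 η f x₀ s hmax R Hs B (k + 1) := by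
    intro k
    unfold injected
    rw [Finset.sum_range_succ]
    have h1 : (0 : ℝ) ≤ (if Charged P St Ready η f x₀ s hmax R Hs B k ∧ ¬ 𝓔 η f x₀ s hmax R Hs B k then (1 : ℝ) else 0) := by
      split_ifs <;> norm_num
    linarith
  induction k with
  | zero =>
    show max (injected P St Ready 𝓔 η f x₀ s hmax R Hs B 0 - 0) 0 = injected P St Ready 𝓔 η f x₀ s hmax R Hs B 0
    have h0 : injected P St Ready 𝓔 η f x₀ s hmax R Hs B 0 = 0 := by unfold injected; simp
    rw [h0]; norm_num
  | succ k ih =>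
    show max (paceMeter P St Ready 𝓔 (fun _ _ _ _ _ _ _ _ _ => 0) η f x₀ s hmax R Hs B k)
        (injected P St Ready 𝓔 η f x₀ s hmax R Hs B (k + 1) - 0) = injected P St Ready 𝓔 η f x₀ s hmax R Hs B (k + 1)
    rw [ih, sub_zero]
    exact max_eq_right (hmono k)
end RhW07.E3.Lit
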